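import Literature.MathematicalPhysics.QuantumManyBody.PeriodicMaxFormSimplicity
import HarnessLib

/-!
# Route `BECProbeMassFlow`, crux `RecoilTransfer` (stmt-AtomisticToContinuum-12311):
# atoms of a finite-dimensional sublattice of `L²((ℝ/ℤ)^{3M})`

Support file for the stub `stub_groundStatesTranslationInvariant` (D′α) of the crux `RecoilTransfer`
(route `BECProbeMassFlow`, line `registered`, skeleton `Cruxes/RecoilTransfer/Lines/birth.lean` v6): the
abstract **lattice algebra of a finite-dimensional `ℂ`-subspace `V ⊆ L²((ℝ/ℤ)^{3M})` closed under the
modulus `|·|` (`absLp`)** — the structure of the maximal-form ground-state class `maxFormGroundStates` of a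
periodic `N`-body Hamiltonian (Reed–Simon's Beurling–Deny lattice, `PeriodicMaxFormGroundStates.lean`), for
hard-core pair potentials where the ground level may be degenerate.

An **atom** of `V` is a non-zero non-negative `h ∈ V` (`|h| = h`) spanning an extremal ray of the cone of
non-negative elements: every non-negative `k ∈ V` with `k ≤ C h` is a real multiple of `h`. The property is
spelled out in every statement (no auxiliary definition). Main results:

* `exists_atom` — a non-zero finite-dimensional sublattice has an atom (minimise the dimension of
  `{f ∈ V | f = 0 a.e. on {h = 0}}` over the non-zero non-negative `h ∈ V`; a connectedness argument on the
  line of real parameters `c` in `(k - c h)^±` gives extremality);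
* `atom_smul_or_inner_eq_zero` — two atoms are proportional or orthogonal (their infimum
  `½ (h + h' - |h - h'|)` is a multiple of both).

The sequel files `…RecoilTransferL2SublatticeBands.lean` (bands of atoms, translations) and
`…RecoilTransferGroundStatesTranslationInvariant.lean` (the stub) use these to show that a connected group
of positivity-preserving lattice isometries fixes `V` pointwise. Elementary (finite-dimensional Riesz
spaces, Yudin's theorem in disguise); tagged folklore.
-/

noncomputable section

namespace Summit.AtomisticToContinuum.BoseEinsteinCondensation.Theorems

open MeasureTheory Filter UnitAddTorus
open scoped ENNReal NNReal InnerProductSpace ComplexConjugate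
open Literature.MathematicalPhysics.QuantumManyBody Literature.MathematicalPhysics.QuantumManyBody.BoseGas
open Literature.Analysis.FunctionSpaces Literature.Analysis.OperatorTheory

-- The measure on `ℝ/ℤ` is the Haar PROBABILITY measure, as in `PeriodicFormDomain.lean` and every maximal-form
-- file of the tree (`absLp`, `maxFormGroundStates`, `translateLp` live on `Lp ℂ 2 (volume : Measure (UnitAddTorus _))`).
attribute [local instance] Literature.MathematicalPhysics.QuantumManyBody.BoseGas.formDomain_measureSpace
  Literature.MathematicalPhysics.QuantumManyBody.BoseGas.formDomain_isProbabilityMeasure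
  Literature.MathematicalPhysics.QuantumManyBody.BoseGas.formDomain_isProbabilityMeasure_pi

/-- Local notation for `L²((ℝ/ℤ)^{3M})`, as in the tree files. -/
local notation "L2T " N':max => Lp ℂ 2 (volume : Measure (UnitAddTorus (Fin N' × Fin 3)))

/-- Local notation for the torus `(ℝ/ℤ)^{3M}`. -/
local notation "𝕋 " N':max => UnitAddTorus (Fin N' × Fin 3)

variable {M : ℕ}

/-! ### Pointwise forms of non-negative classes -/

/-- A non-negative class (`|η| = η`) is a.e. a non-negative real. [folklore] -/
theorem ae_exists_eq_ofReal_of_absLp_eq {η : L2T M} (h : absLp η = η) :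
    ∀ᵐ t ∂(volume : Measure (𝕋 M)), ∃ a : ℝ, 0 ≤ a ∧ (η : 𝕋 M → ℂ) t = (a : ℂ) := by
  have h' := coeFn_absLp η
  rw [h] at h'
  exact h'.mono fun t ht => ⟨_, norm_nonneg _, ht⟩

/-- A class that is a.e. a non-negative real is non-negative (`|η| = η`). [folklore] -/
theorem absLp_eq_self_of_ae {η : L2T M} {r : 𝕋 M → ℝ} (hr : ∀ᵐ t ∂(volume : Measure (𝕋 M)), 0 ≤ r t)
    (h : ∀ᵐ t ∂(volume : Measure (𝕋 M)), (η : 𝕋 M → ℂ) t = ((r t : ℝ) : ℂ)) : absLp η = η := by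
  refine Lp.ext ?_
  filter_upwards [coeFn_absLp η, hr, h] with t h1 h2 h3
  rw [h1, h3, Complex.norm_real, Real.norm_of_nonneg h2]

/-- Non-negative classes are real. [folklore] -/
theorem conjLp_eq_self_of_absLp_eq {η : L2T M} (h : absLp η = η) : conjLp η = η := by
  rw [← h]
  exact conjLp_absLp η

/-- `|η⁻| = η⁻`. [folklore] -/
theorem absLp_negPartLp (η : L2T M) : absLp (negPartLp η) = negPartLp η := by
  refine Lp.ext ?_
  filter_upwards [coeFn_absLp (negPartLp η), coeFn_negPartLp η] with t h1 h2
  rw [h1, h2, Complex.norm_real, Real.norm_of_nonneg (le_max_right _ _)]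

/-- `η ↦ η⁺` is continuous on `L²`. [folklore] -/
theorem continuous_posPartLp : Continuous (posPartLp : L2T M → L2T M) :=
  lipschitzWith_posPartC.continuous_compLp (by simp)

/-- `η ↦ η⁻` is continuous on `L²`. [folklore] -/
theorem continuous_negPartLp : Continuous (negPartLp : L2T M → L2T M) :=
  lipschitzWith_negPartC.continuous_compLp (by simp)

/-! ### The lattice infimum `q ⊓ (C h) = ½ (q + C h - |q - C h|)` of non-negative classes -/

/-- Pointwise, `½ (q + C h - |q - C h|) = min |q| (C |h|)` for non-negative `q`, `h`. [folklore] -/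
theorem coeFn_inf_smul {q h : L2T M} (hqa : absLp q = q) (hha : absLp h = h) (C : ℝ) :
    ∀ᵐ t ∂(volume : Measure (𝕋 M)),
      (((2⁻¹ : ℂ) • (q + (C : ℂ) • h - absLp (q - (C : ℂ) • h)) : L2T M) : 𝕋 M → ℂ) t =
        ((min ‖(q : 𝕋 M → ℂ) t‖ (C * ‖(h : 𝕋 M → ℂ) t‖) : ℝ) : ℂ) := by
  filter_upwards [ae_exists_eq_ofReal_of_absLp_eq hqa, ae_exists_eq_ofReal_of_absLp_eq hha,
    Lp.coeFn_smul (2⁻¹ : ℂ) (q + (C : ℂ) • h - absLp (q - (C : ℂ) • h)),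
    Lp.coeFn_sub (q + (C : ℂ) • h) (absLp (q - (C : ℂ) • h)), Lp.coeFn_add q ((C : ℂ) • h),
    coeFn_absLp (q - (C : ℂ) • h), Lp.coeFn_sub q ((C : ℂ) • h), Lp.coeFn_smul (C : ℂ) h]
    with t ⟨a, ha, h1⟩ ⟨b, hb, h2⟩ h3 h4 h5 h6 h7 h8
  -- `min x y = (x + y - |x - y|) / 2`
  have hmin : ∀ x y : ℝ, min x y = 2⁻¹ * (x + y - |x - y|) := fun x y => by
    have e1 := min_add_max x y
    have e2 := max_sub_min_eq_abs' x y
    linarith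
  rw [h3, Pi.smul_apply, h4, Pi.sub_apply, h5, Pi.add_apply, h6, h7, Pi.sub_apply, h8, Pi.smul_apply, h1, h2,
    smul_eq_mul, smul_eq_mul, ← Complex.ofReal_mul, ← Complex.ofReal_sub, hmin]
  simp only [Complex.norm_real, Real.norm_eq_abs, abs_of_nonneg ha, abs_of_nonneg hb]
  push_cast
  ring

/-- `q ⊓ (C h) ≥ 0` for `C ≥ 0`. [folklore] -/
theorem absLp_inf_smul {q h : L2T M} (hqa : absLp q = q) (hha : absLp h = h) {C : ℝ} (hC : 0 ≤ C) :
    absLp ((2⁻¹ : ℂ) • (q + (C : ℂ) • h - absLp (q - (C : ℂ) • h))) =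
      (2⁻¹ : ℂ) • (q + (C : ℂ) • h - absLp (q - (C : ℂ) • h)) :=
  absLp_eq_self_of_ae (Eventually.of_forall fun _ =>
    le_min (norm_nonneg _) (mul_nonneg hC (norm_nonneg _))) (coeFn_inf_smul hqa hha C)

/-- `q ⊓ (C h) ≤ C h`. [folklore] -/
theorem absLp_smul_sub_inf {q h : L2T M} (hqa : absLp q = q) (hha : absLp h = h) (C : ℝ) :
    absLp ((C : ℂ) • h - (2⁻¹ : ℂ) • (q + (C : ℂ) • h - absLp (q - (C : ℂ) • h))) =
      (C : ℂ) • h - (2⁻¹ : ℂ) • (q + (C : ℂ) • h - absLp (q - (C : ℂ) • h)) := by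
  refine absLp_eq_self_of_ae (r := fun t => C * ‖(h : 𝕋 M → ℂ) t‖ - min ‖(q : 𝕋 M → ℂ) t‖ (C * ‖(h : 𝕋 M → ℂ) t‖))
    (Eventually.of_forall fun t => sub_nonneg.2 (min_le_right _ _)) ?_
  filter_upwards [coeFn_inf_smul hqa hha C, ae_exists_eq_ofReal_of_absLp_eq hha,
    Lp.coeFn_sub ((C : ℂ) • h) ((2⁻¹ : ℂ) • (q + (C : ℂ) • h - absLp (q - (C : ℂ) • h))), Lp.coeFn_smul (C : ℂ) h]
    with t h1 ⟨b, hb, h2⟩ h3 h4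
  rw [h3, Pi.sub_apply, h4, Pi.smul_apply, h1, h2, smul_eq_mul, Complex.norm_real, Real.norm_of_nonneg hb]
  push_cast
  ring

/-- `q ⊓ (C h) ≤ q`. [folklore] -/
theorem absLp_self_sub_inf {q h : L2T M} (hqa : absLp q = q) (hha : absLp h = h) (C : ℝ) :
    absLp (q - (2⁻¹ : ℂ) • (q + (C : ℂ) • h - absLp (q - (C : ℂ) • h))) =
      q - (2⁻¹ : ℂ) • (q + (C : ℂ) • h - absLp (q - (C : ℂ) • h)) := by
  refine absLp_eq_self_of_ae (r := fun t => ‖(q : 𝕋 M → ℂ) t‖ - min ‖(q : 𝕋 M → ℂ) t‖ (C * ‖(h : 𝕋 M → ℂ) t‖))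
    (Eventually.of_forall fun t => sub_nonneg.2 (min_le_left _ _)) ?_
  filter_upwards [coeFn_inf_smul hqa hha C, ae_exists_eq_ofReal_of_absLp_eq hqa,
    Lp.coeFn_sub q ((2⁻¹ : ℂ) • (q + (C : ℂ) • h - absLp (q - (C : ℂ) • h)))] with t h1 ⟨a, ha, h2⟩ h3
  rw [h3, Pi.sub_apply, h1, h2, Complex.norm_real, Real.norm_of_nonneg ha]
  push_cast
  ring

/-- The infimum of two elements of a sublattice lies in it. [folklore] -/
theorem inf_smul_mem (V : Submodule ℂ (L2T M)) (hVa : ∀ f ∈ V, absLp f ∈ V) {q h : L2T M} (hq : q ∈ V)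
    (hh : h ∈ V) (C : ℝ) : (2⁻¹ : ℂ) • (q + (C : ℂ) • h - absLp (q - (C : ℂ) • h)) ∈ V :=
  V.smul_mem _ (V.sub_mem (V.add_mem hq (V.smul_mem _ hh)) (hVa _ (V.sub_mem hq (V.smul_mem _ hh))))


/-! ### Atoms of a finite-dimensional sublattice of `L²`

An **atom** of a `ℂ`-subspace `V ⊆ L²((ℝ/ℤ)^{3M})` closed under `|·|` is a non-zero non-negative `h ∈ V`
generating an extremal ray of the cone of non-negative elements of `V`: every non-negative `k ∈ V`
below a multiple of `h` (`C h - k ≥ 0`) is a real multiple of `h`. We spell this property out in each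
statement (no auxiliary definition). -/

/-- **Atoms exist** in every non-zero finite-dimensional sublattice `V` of `L²` (a `ℂ`-subspace closed
under `|·|`). Take a non-zero non-negative `h ∈ V` minimising the dimension of
`W(h) = {f ∈ V | f = 0 a.e. on {h = 0}}`; then every non-zero non-negative element of `W(h)` has the
zero set of `h`, so for `0 ≤ k ≤ C h` and every real `c` one of `(k - c h)^±` vanishes (they have disjoint
supports), and the closed sets `{c | (k - c h)⁻ = 0} ∋ 0`, `{c | (k - c h)⁺ = 0} ∋ C` cover the connected
line, hence meet: `k = c h`. [folklore] -/
theorem exists_atom (V : Submodule ℂ (L2T M)) [FiniteDimensional ℂ V] (hVa : ∀ f ∈ V, absLp f ∈ V)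
    (hV : V ≠ ⊥) :
    ∃ h ∈ V, h ≠ 0 ∧ absLp h = h ∧
      ∀ k ∈ V, absLp k = k → (∃ C : ℝ, absLp ((C : ℂ) • h - k) = (C : ℂ) • h - k) → ∃ c : ℝ, k = (c : ℂ) • h := by
  classical
  -- the sublattices `W x = {f ∈ V | f = 0 a.e. where x = 0}`
  let W : (L2T M) → Submodule ℂ (L2T M) := fun x =>
    { carrier := {f | f ∈ V ∧ ∀ᵐ t ∂(volume : Measure (𝕋 M)), (x : 𝕋 M → ℂ) t = 0 → (f : 𝕋 M → ℂ) t = 0}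
      zero_mem' := ⟨V.zero_mem, (Lp.coeFn_zero ℂ 2 (volume : Measure (𝕋 M))).mono fun t ht _ => by
        rw [ht, Pi.zero_apply]⟩
      add_mem' := fun {f g} hf hg => ⟨V.add_mem hf.1 hg.1, by
        filter_upwards [hf.2, hg.2, Lp.coeFn_add f g] with t h1 h2 h3 ht
        rw [h3, Pi.add_apply, h1 ht, h2 ht, add_zero]⟩
      smul_mem' := fun c f hf => ⟨V.smul_mem c hf.1, by
        filter_upwards [hf.2, Lp.coeFn_smul c f] with t h1 h3 ht
        rw [h3, Pi.smul_apply, h1 ht, smul_zero]⟩ }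
  have hWV : ∀ x, W x ≤ V := fun x f hf => hf.1
  haveI : ∀ x, FiniteDimensional ℂ (W x) := fun x => Submodule.finiteDimensional_of_le (hWV x)
  -- a non-zero non-negative `h ∈ V` minimising `dim W(h)`
  obtain ⟨f₀, hf₀V, hf₀⟩ := (Submodule.ne_bot_iff V).1 hV
  have hP : ∃ d : ℕ, ∃ x ∈ V, x ≠ 0 ∧ absLp x = x ∧ Module.finrank ℂ (W x) = d := by
    refine ⟨_, absLp f₀, hVa f₀ hf₀V, fun h0 => hf₀ ?_, absLp_absLp f₀, rfl⟩
    have h1 := norm_absLp f₀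
    rw [h0, norm_zero] at h1
    exact norm_eq_zero.1 h1.symm
  obtain ⟨h, hhV, hh0, hha, hhd⟩ := Nat.find_spec hP
  have hmin : ∀ x ∈ V, x ≠ 0 → absLp x = x → Module.finrank ℂ (W h) ≤ Module.finrank ℂ (W x) := by
    intro x hxV hx0 hxa
    rw [hhd]
    exact Nat.find_min' hP ⟨x, hxV, hx0, hxa, rfl⟩
  -- KEY: `h` vanishes a.e. on the zero set of every non-zero non-negative element of `W(h)`
  have key : ∀ x ∈ W h, x ≠ 0 → absLp x = x →
      ∀ᵐ t ∂(volume : Measure (𝕋 M)), (x : 𝕋 M → ℂ) t = 0 → (h : 𝕋 M → ℂ) t = 0 := by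
    intro x hx hx0 hxa
    have hle : W x ≤ W h := fun f hf => ⟨hf.1, by
      filter_upwards [hf.2, hx.2] with t h1 h2 ht
      exact h1 (h2 ht)⟩
    have heq : W x = W h := Submodule.eq_of_le_of_finrank_le hle (hmin x hx.1 hx0 hxa)
    have hhW : h ∈ W x := by
      rw [heq]
      exact ⟨hhV, Eventually.of_forall fun t ht => ht⟩
    exact hhW.2
  refine ⟨h, hhV, hh0, hha, fun k hkV hka ⟨C, hC⟩ => ?_⟩
  have hhr : conjLp h = h := conjLp_eq_self_of_absLp_eq hha
  have hkr : conjLp k = k := conjLp_eq_self_of_absLp_eq hka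
  -- `k` vanishes where `h` does (`0 ≤ k ≤ C h`)
  have hk0 : ∀ᵐ t ∂(volume : Measure (𝕋 M)), (h : 𝕋 M → ℂ) t = 0 → (k : 𝕋 M → ℂ) t = 0 := by
    filter_upwards [ae_exists_eq_ofReal_of_absLp_eq hka, ae_exists_eq_ofReal_of_absLp_eq hC,
      Lp.coeFn_sub ((C : ℂ) • h) k, Lp.coeFn_smul (C : ℂ) h] with t ⟨a, ha, h1⟩ ⟨b, hb, h2⟩ h3 h4 ht
    rw [h3, Pi.sub_apply, h4, Pi.smul_apply, ht, smul_zero, zero_sub, h1] at h2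
    have h5 : -a = b := by exact_mod_cast h2
    have h6 : a = 0 := by linarith
    rw [h1, h6, Complex.ofReal_zero]
  -- the real classes `k - c h`, their positive and negative parts
  have hr : ∀ c : ℝ, conjLp (k - (c : ℂ) • h) = k - (c : ℂ) • h := fun c => conjLp_sub_ofReal_smul hkr hhr c
  have hsubV : ∀ c : ℝ, k - (c : ℂ) • h ∈ V := fun c => V.sub_mem hkV (V.smul_mem _ hhV)
  have hpW : ∀ c : ℝ, posPartLp (k - (c : ℂ) • h) ∈ W h := fun c => by
    refine ⟨?_, ?_⟩
    · rw [posPartLp_eq_of_conjLp_eq (hr c)]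
      exact V.smul_mem _ (V.add_mem (hVa _ (hsubV c)) (hsubV c))
    · filter_upwards [hk0, coeFn_posPartLp (k - (c : ℂ) • h), Lp.coeFn_sub k ((c : ℂ) • h),
        Lp.coeFn_smul (c : ℂ) h] with t h1 h2 h3 h4 ht
      rw [h2, h3, Pi.sub_apply, h4, Pi.smul_apply, ht, h1 ht, smul_zero, sub_zero, Complex.zero_re, max_self,
        Complex.ofReal_zero]
  have hnW : ∀ c : ℝ, negPartLp (k - (c : ℂ) • h) ∈ W h := fun c => by
    refine ⟨?_, ?_⟩
    · rw [negPartLp_eq_of_conjLp_eq (hr c)]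
      exact V.smul_mem _ (V.sub_mem (hVa _ (hsubV c)) (hsubV c))
    · filter_upwards [hk0, coeFn_negPartLp (k - (c : ℂ) • h), Lp.coeFn_sub k ((c : ℂ) • h),
        Lp.coeFn_smul (c : ℂ) h] with t h1 h2 h3 h4 ht
      rw [h2, h3, Pi.sub_apply, h4, Pi.smul_apply, ht, h1 ht, smul_zero, sub_zero, Complex.zero_re, neg_zero,
        max_self, Complex.ofReal_zero]
  -- dichotomy: for every real `c`, `(k - c h)⁺ = 0` or `(k - c h)⁻ = 0`
  have hdich : ∀ c : ℝ, posPartLp (k - (c : ℂ) • h) = 0 ∨ negPartLp (k - (c : ℂ) • h) = 0 := by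
    intro c
    by_contra hcon
    rw [not_or] at hcon
    have h1 := key _ (hpW c) hcon.1 (absLp_posPartLp _)
    have h2 := key _ (hnW c) hcon.2 (absLp_negPartLp _)
    refine hh0 (Lp.eq_zero_iff_ae_eq_zero.2 ?_)
    filter_upwards [h1, h2, coeFn_posPartLp (k - (c : ℂ) • h), coeFn_negPartLp (k - (c : ℂ) • h)]
      with t h3 h4 h5 h6
    rw [Pi.zero_apply]
    rcases le_total (((k - (c : ℂ) • h : L2T M) : 𝕋 M → ℂ) t).re 0 with hle | hle
    · exact h3 (by rw [h5, max_eq_right hle, Complex.ofReal_zero])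
    · exact h4 (by rw [h6, max_eq_right (neg_nonpos.2 hle), Complex.ofReal_zero])
  -- the closed sets `A = {c | (k - c h)⁻ = 0} ∋ 0` and `B = {c | (k - c h)⁺ = 0} ∋ C` cover `ℝ`, hence meet
  have hcont : Continuous fun c : ℝ => (k - (c : ℂ) • h : L2T M) :=
    continuous_const.sub (Complex.continuous_ofReal.smul continuous_const)
  have hA : IsClosed {c : ℝ | negPartLp (k - (c : ℂ) • h) = 0} :=
    isClosed_eq (continuous_negPartLp.comp hcont) continuous_const
  have hB : IsClosed {c : ℝ | posPartLp (k - (c : ℂ) • h) = 0} :=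
    isClosed_eq (continuous_posPartLp.comp hcont) continuous_const
  have h0A : negPartLp (k - ((0 : ℝ) : ℂ) • h) = 0 := by
    rw [Complex.ofReal_zero, zero_smul, sub_zero, negPartLp_eq_of_conjLp_eq hkr, hka, sub_self, smul_zero]
  have hCB : posPartLp (k - (C : ℂ) • h) = 0 := by
    rw [posPartLp_eq_of_conjLp_eq (hr C), show absLp (k - (C : ℂ) • h) = (C : ℂ) • h - k by
      rw [← absLp_neg, neg_sub, hC], sub_add_sub_cancel, sub_self, smul_zero]
  obtain ⟨c, -, hcA, hcB⟩ := isPreconnected_closed_iff.1 isPreconnected_univ _ _ hA hB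
    (fun c _ => (hdich c).elim (fun hp => Or.inr hp) fun hn => Or.inl hn) ⟨0, Set.mem_univ _, h0A⟩
    ⟨C, Set.mem_univ _, hCB⟩
  have hcA' : negPartLp (k - (c : ℂ) • h) = 0 := hcA
  have hcB' : posPartLp (k - (c : ℂ) • h) = 0 := hcB
  refine ⟨c, ?_⟩
  have h1 := posPartLp_sub_negPartLp (hr c)
  rw [hcA', hcB', sub_zero] at h1
  exact (sub_eq_zero.1 h1.symm)


/-- **Two atoms are proportional or orthogonal**: their infimum `h ⊓ h' = ½ (h + h' - |h - h'|)` lies below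
both, so it is a multiple of each; if it vanishes, `min(|h|, |h'|) = 0` a.e. and `⟪h, h'⟫ = ∫ |h| |h'| = 0`.
[folklore] -/
theorem atom_smul_or_inner_eq_zero (V : Submodule ℂ (L2T M)) (hVa : ∀ f ∈ V, absLp f ∈ V) {h h' : L2T M}
    (hh : h ∈ V) (hha : absLp h = h)
    (hhe : ∀ k ∈ V, absLp k = k → (∃ C : ℝ, absLp ((C : ℂ) • h - k) = (C : ℂ) • h - k) → ∃ c : ℝ, k = (c : ℂ) • h)
    (hh' : h' ∈ V) (hh'a : absLp h' = h')
    (hh'e : ∀ k ∈ V, absLp k = k → (∃ C : ℝ, absLp ((C : ℂ) • h' - k) = (C : ℂ) • h' - k) →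
      ∃ c : ℝ, k = (c : ℂ) • h') :
    (∃ c : ℝ, h' = (c : ℂ) • h) ∨ ⟪h, h'⟫_ℂ = 0 := by
  -- the infimum `m = h' ⊓ h = ½ (h' + 1 • h - |h' - 1 • h|)`
  have hm_ae := coeFn_inf_smul hh'a hha 1
  have hmV := inf_smul_mem V hVa hh' hh 1
  have hm0 := absLp_inf_smul hh'a hha zero_le_one
  obtain ⟨c, hc⟩ := hhe _ hmV hm0 ⟨1, absLp_smul_sub_inf hh'a hha 1⟩
  obtain ⟨c', hc'⟩ := hh'e _ hmV hm0 ⟨1, by rw [Complex.ofReal_one, one_smul]; exact absLp_self_sub_inf hh'a hha 1⟩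
  by_cases hm : ((2⁻¹ : ℂ) • (h' + ((1 : ℝ) : ℂ) • h - absLp (h' - ((1 : ℝ) : ℂ) • h)) : L2T M) = 0
  · right
    rw [hm] at hm_ae
    rw [L2.inner_def]
    refine integral_eq_zero_of_ae ?_
    filter_upwards [hm_ae, Lp.coeFn_zero ℂ 2 (volume : Measure (𝕋 M)), ae_exists_eq_ofReal_of_absLp_eq hha,
      ae_exists_eq_ofReal_of_absLp_eq hh'a] with t h1 h2 ⟨a, ha, h3⟩ ⟨a', ha', h4⟩
    rw [h2, Pi.zero_apply, h3, h4, Complex.norm_real, Complex.norm_real, Real.norm_of_nonneg ha,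
      Real.norm_of_nonneg ha', one_mul] at h1
    rw [Pi.zero_apply, RCLike.inner_apply', h3, h4, Complex.conj_ofReal, ← Complex.ofReal_mul, Complex.ofReal_eq_zero]
    have h5 : min a' a = 0 := by exact_mod_cast h1.symm
    rcases min_eq_iff.1 h5 with ⟨h6, -⟩ | ⟨h6, -⟩
    · rw [h6, mul_zero]
    · rw [h6, zero_mul]
  · left
    have hc'0 : c' ≠ 0 := by
      rintro rfl
      rw [Complex.ofReal_zero, zero_smul] at hc'
      exact hm hc'
    refine ⟨c'⁻¹ * c, ?_⟩
    rw [Complex.ofReal_mul, mul_smul, ← hc, hc', smul_smul, Complex.ofReal_inv,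
      inv_mul_cancel₀ (Complex.ofReal_ne_zero.2 hc'0), one_smul]

/-- **Atoms exist** — registered sub-goal form of `exists_atom` (helper 1/3 of stub D′α
`stub_groundStatesTranslationInvariant` of crux `RecoilTransfer`): every non-zero finite-dimensional
`ℂ`-subspace of `L²((ℝ/ℤ)^{3M})` closed under `|·|` has an atom. [folklore] -/
theorem exists_sublattice_atom :
    ∀ {M : ℕ} (V : Submodule ℂ (Lp ℂ 2 (volume : Measure (UnitAddTorus (Fin M × Fin 3))))) [FiniteDimensional ℂ V],
      (∀ f ∈ V, absLp f ∈ V) → V ≠ ⊥ →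
        ∃ h ∈ V, h ≠ 0 ∧ absLp h = h ∧
          ∀ k ∈ V, absLp k = k → (∃ C : ℝ, absLp ((C : ℂ) • h - k) = (C : ℂ) • h - k) → ∃ c : ℝ, k = (c : ℂ) • h :=
  fun V _ hVa hV => exists_atom V hVa hV

end Summit.AtomisticToContinuum.BoseEinsteinCondensation.Theorems
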